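import Literature.NumberTheory.Sieve.CFSemigroupBoundary
import Literature.NumberTheory.Sieve.CFSemigroupResolventResidue
import HarnessLib

/-!
# The resolvent `s ↦ ((1 - L_s)^{-1} 𝟙)(x)` on the closed half-plane `Re s ≥ δ_A`

Support file (all results proved) for the named fact
`Literature.NumberTheory.Sieve.MageeOhWinter2019_uniformCounting` (`CFSemigroupCounting.lean`).
The Laplace transform of Lalley's renewal counting function `N(a, x)` is
`Σ_n (L_sⁿ 𝟙)(x) = ((1 - L_s)^{-1} 𝟙)(x)` ([MageeOhWinter2019, (3.5)–(3.7)]). This file assembles the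
analytic facts about this function needed for the Tauberian argument ([MageeOhWinter2019,
Lemma 15, Prop. 17]; Lalley's Thm. 1 via Wiener–Ikehara):

* `tsum_pow_mul_one_sub`, `inverse_one_sub_eq_tsum`: Neumann series with summable powers;
* `summable_norm_cfLOp_pow`, `isUnit_one_sub_cfLOp_of_lt`: for `Re s > δ`, `Σ ‖L_sⁿ‖ < ∞`
  (`λ_{Re s} < 1` by Bowen's formula and strict monotonicity of the pressure), so
  `(1 - L_s)^{-1} = Σ L_sⁿ`;
* `isUnit_one_sub_cfLOp`: `1 - L_s` is a unit on `{Re s ≥ δ} \ {δ}` (interior: Neumann series;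
  boundary: `isUnit_one_sub_cfLOp_boundary`), and `continuousAt_inverse_one_sub_cfLOp`;
* `isUnit_one_add_cfLOp`: `1 + L_s` is a unit on all of `{Re s ≥ δ}` (at `δ`: `L_δ = Π + Q` and a
  rank-one Sherman–Morrison step), `continuousAt_inverse_one_add_cfLOp` — used for counting words of
  even length (`Γ_A` consists of even words), `Σ_n L^{2n} = ½ (1 - L)^{-1} + ½ (1 + L)^{-1}`;
* `cfResFun G x s = ((1 - L_s)^{-1} G)(x)` (`G ∈ CfLip` a test function, `G = 𝟙` for plain
  counting): continuous on `{Re s ≥ δ} \ {δ}`, equal to the series `Σ_n (L_sⁿ G)(x)` for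
  `Re s > δ` (`cfResFun_eq_tsum`), and near `δ` of the form `w(s) + ν(G) h(x) / ((s - δ) κ)` with
  `w` continuous at `δ`, `κ = ∫ 2 h log(1/·) dν > 0` (`cfResFun_near_delta`): a simple pole with
  residue `ν(G) h(x)/κ`. [cite: MageeOhWinter2019, Prop. 17]

## References

* M. Magee, H. Oh, D. Winter, J. reine angew. Math. 753 (2019) 89–135, §3.1, Lemma 15, Prop. 17.
  [MageeOhWinter2019]
* S. P. Lalley, Acta Math. 163 (1989) 1–55, §2, Thm. 1.
-/

noncomputable section

open Set Filter Metric MeasureTheory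
open scoped Topology

namespace Literature.NumberTheory.Sieve

variable {A : Finset ℕ}

/-! ### Neumann series with summable powers -/

section Neumann

variable {R : Type*} [NormedRing R] [CompleteSpace R]

/-- **Neumann series:** if `Σ ‖Tⁿ‖ < ∞` then `Σ Tⁿ` is a two-sided inverse of `1 - T`. [folklore] -/
theorem tsum_pow_mul_one_sub {T : R} (h : Summable fun n => ‖T ^ n‖) :
    (1 - T) * (∑' n, T ^ n) = 1 ∧ (∑' n, T ^ n) * (1 - T) = 1 := by
  have hs : Summable fun n => T ^ n := h.of_norm
  have h0 := hs.tsum_eq_zero_add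
  have h1 : ∑' n, T ^ (n + 1) = T * ∑' n, T ^ n := by
    rw [← hs.tsum_mul_left]
    exact tsum_congr fun n => by rw [pow_succ']
  have h2 : ∑' n, T ^ (n + 1) = (∑' n, T ^ n) * T := by
    rw [← hs.tsum_mul_right]
    exact tsum_congr fun n => by rw [pow_succ]
  constructor
  · rw [sub_mul, one_mul, ← h1]
    conv_lhs => rw [h0]
    rw [pow_zero, add_sub_cancel_right]
  · rw [mul_sub, mul_one, ← h2]
    conv_lhs => rw [h0]
    rw [pow_zero, add_sub_cancel_right]

/-- `1 - T` is a unit if `Σ ‖Tⁿ‖ < ∞`. [folklore] -/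
theorem isUnit_one_sub_of_summable_norm_pow {T : R} (h : Summable fun n => ‖T ^ n‖) : IsUnit (1 - T) :=
  ⟨⟨1 - T, ∑' n, T ^ n, (tsum_pow_mul_one_sub h).1, (tsum_pow_mul_one_sub h).2⟩, rfl⟩

/-- `(1 - T)^{-1} = Σ Tⁿ` if `Σ ‖Tⁿ‖ < ∞` (a two-sided inverse is the ring inverse, `Ring.inverse_unit`).
[folklore] -/
theorem inverse_one_sub_eq_tsum {T : R} (h : Summable fun n => ‖T ^ n‖) : Ring.inverse (1 - T) = ∑' n, T ^ n :=
  Ring.inverse_unit ⟨1 - T, ∑' n, T ^ n, (tsum_pow_mul_one_sub h).1, (tsum_pow_mul_one_sub h).2⟩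

end Neumann

/-! ### The open half-plane `Re s > δ` -/

section HalfPlane

variable (A) (hA : ∀ a ∈ A, 1 ≤ a) (h2 : 2 ≤ A.card)
include hA h2

/-- `λ_σ < 1` for `σ > δ_A` (Bowen's formula and strict monotonicity of the pressure).
[cite: MageeOhWinter2019, §2.2] -/
theorem cfEig_lt_one_of_lt {σ : ℝ} (hσ : cfDimension A < σ) : cfEig A σ < 1 := by
  rw [cfEig]
  rw [cfDimension_eq_cfPressureZero hA h2] at hσ
  exact Real.exp_lt_one_iff.2 (cfPressure_neg_of_lt hA h2 hσ)

/-- **`Σ ‖L_sⁿ‖ < ∞` for `Re s > δ`.** [cite: MageeOhWinter2019, Thm. 10] -/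
theorem summable_norm_cfLOp_pow {s : ℂ} (hs : cfDimension A < s.re) : Summable fun n => ‖cfLOp A hA s ^ n‖ := by
  have hne := nonempty_of_two_le_card h2
  have hσ0 : 0 ≤ s.re := (cfDimension_pos hA h2).le.trans hs.le
  have hlt := cfEig_lt_one_of_lt A hA h2 hs
  have hl0 := (cfEig_pos (A := A) s.re).le
  refine Summable.of_nonneg_of_le (fun n => norm_nonneg _) (fun n => norm_cfLOp_pow_le A hA hne hσ0 n) ?_
  exact ((summable_geometric_of_lt_one hl0 hlt).mul_left ((4 : ℝ) ^ s.re)).mul_right _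

/-- `1 - L_s` is a unit for `Re s > δ`, with inverse the Neumann series. [cite: MageeOhWinter2019, §3.1] -/
theorem isUnit_one_sub_cfLOp_of_lt {s : ℂ} (hs : cfDimension A < s.re) : IsUnit (1 - cfLOp A hA s) :=
  isUnit_one_sub_of_summable_norm_pow (summable_norm_cfLOp_pow A hA h2 hs)

/-- `(1 - L_s)^{-1} = Σ L_sⁿ` for `Re s > δ`. [cite: MageeOhWinter2019, §3.1 eq. (3.6)] -/
theorem inverse_one_sub_cfLOp_of_lt {s : ℂ} (hs : cfDimension A < s.re) :
    Ring.inverse (1 - cfLOp A hA s) = ∑' n, cfLOp A hA s ^ n :=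
  inverse_one_sub_eq_tsum (summable_norm_cfLOp_pow A hA h2 hs)

/-! ### The closed half-plane minus the pole -/

/-- **`1 - L_s` is a unit on `{Re s ≥ δ} \ {δ}`.** [cite: MageeOhWinter2019, Lemma 15] -/
theorem isUnit_one_sub_cfLOp {s : ℂ} (hs : cfDimension A ≤ s.re) (hne : s ≠ (cfDimension A : ℂ)) :
    IsUnit (1 - cfLOp A hA s) := by
  rcases hs.lt_or_eq with hlt | heq
  · exact isUnit_one_sub_cfLOp_of_lt A hA h2 hlt
  · have ht : s.im ≠ 0 := by
      intro h0
      apply hne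
      apply Complex.ext
      · simp [← heq]
      · simp [h0]
    have hs' : s = (cfDimension A : ℂ) + s.im * Complex.I := by
      apply Complex.ext
      · simp [← heq]
      · simp
    rw [hs']
    exact isUnit_one_sub_cfLOp_boundary A hA h2 ht

/-- **Continuity of the resolvent** `s ↦ (1 - L_s)^{-1}` at every point of `{Re s ≥ δ} \ {δ}`.
[cite: MageeOhWinter2019, Lemma 15] -/
theorem continuousAt_inverse_one_sub_cfLOp {s : ℂ} (hs : cfDimension A ≤ s.re) (hne : s ≠ (cfDimension A : ℂ)) :
    ContinuousAt (fun s => Ring.inverse (1 - cfLOp A hA s)) s := by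
  obtain ⟨u, hu⟩ := isUnit_one_sub_cfLOp A hA h2 hs hne
  have h1 : ContinuousAt Ring.inverse ((1 : CfLip →L[ℂ] CfLip) - cfLOp A hA s) := by
    rw [← hu]
    exact NormedRing.inverse_continuousAt u
  have h2' : ContinuousAt (fun s => (1 : CfLip →L[ℂ] CfLip) - cfLOp A hA s) s :=
    (continuous_const.sub (continuous_cfLOp A hA)).continuousAt
  exact ContinuousAt.comp (g := Ring.inverse) h1 h2'

/-! ### Invertibility of `1 + L_s` on the closed half-plane `Re s ≥ δ` -/

omit hA h2 in
/-- `‖(-T)ⁿ‖ = ‖Tⁿ‖` in any normed ring. [folklore] -/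
theorem norm_neg_pow' {R : Type*} [NormedRing R] (T : R) (n : ℕ) : ‖(-T) ^ n‖ = ‖T ^ n‖ := by
  rcases neg_one_pow_eq_or R n with h | h <;> rw [neg_pow, h]
  · rw [one_mul]
  · rw [neg_one_mul, norm_neg]

/-- `Σ ‖Qⁿ‖ < ∞` for `Q = L_δ - Π`. [folklore] -/
theorem summable_norm_cfQδ_pow : Summable fun n => ‖cfQδ A hA h2 ^ n‖ := by
  have hρ0 := (cfRho_pos (A := A)).le
  have hρ1 := cfRho_lt_one hA h2
  refine Summable.of_nonneg_of_le (fun n => norm_nonneg _) (fun n => norm_cfQδ_pow_le A hA h2 n) ?_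
  exact (summable_geometric_of_lt_one hρ0 hρ1).mul_left _

/-- **`1 + L_δ` is a unit** (`-1` is not an eigenvalue of `L_δ`: `L_δ = Π + Q` with `Σ ‖Qⁿ‖ < ∞`, and
`ν((1 + Q)^{-1} h) = ν(h) = 1 ≠ -1` in the rank-one step). [cite: MageeOhWinter2019, Thm. 10] -/
theorem isUnit_one_add_cfLOp_delta : IsUnit (1 + cfLOp A hA (cfDimension A : ℂ)) := by
  set Q := cfQδ A hA h2 with hQ
  have hL : cfLOp A hA (cfDimension A : ℂ) = cfPi A hA h2 + Q := by rw [hQ, cfQδ]; abel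
  -- `1 + Q` is a unit
  have hsum : Summable fun n => ‖(-Q) ^ n‖ :=
    (summable_norm_cfQδ_pow A hA h2).congr fun n => (norm_neg_pow' Q n).symm
  obtain ⟨hVl, hVr⟩ := tsum_pow_mul_one_sub hsum
  set V : CfLip →L[ℂ] CfLip := ∑' n, (-Q) ^ n with hV
  rw [sub_neg_eq_add] at hVl hVr
  have hV1 : IsUnit (1 + Q) := ⟨⟨1 + Q, V, hVl, hVr⟩, rfl⟩
  -- `V h = h`
  have hVh : V (cfHL A hA h2) = cfHL A hA h2 := by
    have e1 : (1 + Q) (cfHL A hA h2) = cfHL A hA h2 := by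
      show cfHL A hA h2 + Q (cfHL A hA h2) = cfHL A hA h2
      rw [hQ, cfQδ_cfHL, add_zero]
    calc V (cfHL A hA h2) = V ((1 + Q) (cfHL A hA h2)) := by rw [e1]
      _ = (V * (1 + Q)) (cfHL A hA h2) := rfl
      _ = cfHL A hA h2 := by rw [hVr]; rfl
  -- `1 + L_δ = (1 + Q)(1 + V Π)` and `1 + V Π = 1 - (-ν) ⊗ (V h)` is a unit by Sherman–Morrison
  have hVPi : V * cfPi A hA h2 = (cfNuL A hA h2).smulRight (V (cfHL A hA h2)) := by
    refine ContinuousLinearMap.ext fun F => ?_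
    show V (cfPi A hA h2 F) = _
    rw [cfPi_apply, map_smul, ContinuousLinearMap.smulRight_apply]
  have hfac : 1 + cfLOp A hA (cfDimension A : ℂ) = (1 + Q) * (1 - (-cfNuL A hA h2).smulRight (V (cfHL A hA h2))) := by
    have hneg : (-cfNuL A hA h2).smulRight (V (cfHL A hA h2)) = -(V * cfPi A hA h2) := by
      rw [hVPi]
      refine ContinuousLinearMap.ext fun F => ?_
      simp [ContinuousLinearMap.smulRight_apply]
    rw [hneg, sub_neg_eq_add, mul_add, mul_one, ← mul_assoc, hVl, one_mul, hL]
    abel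
  have hne : (-cfNuL A hA h2) (V (cfHL A hA h2)) ≠ 1 := by
    show -(cfNuL A hA h2 (V (cfHL A hA h2))) ≠ 1
    rw [hVh, cfNuL_cfHL]
    norm_num
  obtain ⟨hJl, hJr⟩ := one_sub_smulRight_inverse (-cfNuL A hA h2) (V (cfHL A hA h2)) hne
  have hJ : IsUnit (1 - (-cfNuL A hA h2).smulRight (V (cfHL A hA h2))) := ⟨⟨_, _, hJl, hJr⟩, rfl⟩
  rw [hfac]
  exact hV1.mul hJ

/-- **`1 + L_s` is a unit on the closed half-plane `Re s ≥ δ`.** [cite: MageeOhWinter2019, Lemma 15] -/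
theorem isUnit_one_add_cfLOp {s : ℂ} (hs : cfDimension A ≤ s.re) : IsUnit (1 + cfLOp A hA s) := by
  rcases hs.lt_or_eq with hlt | heq
  · have hsum : Summable fun n => ‖(-cfLOp A hA s) ^ n‖ :=
      (summable_norm_cfLOp_pow A hA h2 hlt).congr fun n => (norm_neg_pow' _ n).symm
    have h := isUnit_one_sub_of_summable_norm_pow hsum
    rwa [sub_neg_eq_add] at h
  · by_cases ht : s.im = 0
    · have hs' : s = (cfDimension A : ℂ) := Complex.ext (by simp [← heq]) (by simp [ht])
      rw [hs']
      exact isUnit_one_add_cfLOp_delta A hA h2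
    · have hs' : s = (cfDimension A : ℂ) + s.im * Complex.I := Complex.ext (by simp [← heq]) (by simp)
      rw [hs']
      exact isUnit_one_add_cfLOp_boundary A hA h2 ht

/-- **Continuity of `s ↦ (1 + L_s)^{-1}`** at every point of the closed half-plane `Re s ≥ δ`.
[cite: MageeOhWinter2019, Lemma 15] -/
theorem continuousAt_inverse_one_add_cfLOp {s : ℂ} (hs : cfDimension A ≤ s.re) :
    ContinuousAt (fun s => Ring.inverse (1 + cfLOp A hA s)) s := by
  obtain ⟨u, hu⟩ := isUnit_one_add_cfLOp A hA h2 hs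
  have h1 : ContinuousAt Ring.inverse ((1 : CfLip →L[ℂ] CfLip) + cfLOp A hA s) := by
    rw [← hu]
    exact NormedRing.inverse_continuousAt u
  have h2' : ContinuousAt (fun s => (1 : CfLip →L[ℂ] CfLip) + cfLOp A hA s) s :=
    (continuous_const.add (continuous_cfLOp A hA)).continuousAt
  exact ContinuousAt.comp (g := Ring.inverse) h1 h2'

/-! ### The scalar resolvent functions `F_{G,x}(s) = ((1 - L_s)^{-1} G)(x)` -/

/-- `F_{G,x}(s) = ((1 - L_s)^{-1} G)(x)` (the ring inverse; the genuine resolvent off the pole), for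
a test function `G ∈ CfLip` (`G = 𝟙` for plain counting). [cite: MageeOhWinter2019, §3.1 eq. (3.7)] -/
def cfResFun (G : CfLip) (x : Icc (0 : ℝ) 1) (s : ℂ) : ℂ := Ring.inverse (1 - cfLOp A hA s) G x

/-- `F_{G,x}` is continuous at every point of `{Re s ≥ δ} \ {δ}`. [cite: MageeOhWinter2019, Lemma 15] -/
theorem continuousAt_cfResFun (G : CfLip) (x : Icc (0 : ℝ) 1) {s : ℂ} (hs : cfDimension A ≤ s.re)
    (hne : s ≠ (cfDimension A : ℂ)) : ContinuousAt (cfResFun A hA G x) s := by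
  have hΦ : Continuous fun T : CfLip →L[ℂ] CfLip => T G x :=
    (CfLip.eval x).continuous.comp (ContinuousLinearMap.apply ℂ CfLip G).continuous
  exact hΦ.continuousAt.comp (continuousAt_inverse_one_sub_cfLOp A hA h2 hs hne)

/-- **Series representation for `Re s > δ`:** `F_{G,x}(s) = Σ_n (L_sⁿ G)(x)`.
[cite: MageeOhWinter2019, §3.1 eq. (3.6)] -/
theorem cfResFun_eq_tsum (G : CfLip) (x : Icc (0 : ℝ) 1) {s : ℂ} (hs : cfDimension A < s.re) :
    cfResFun A hA G x s = ∑' n, (cfLOp A hA s ^ n) G x := by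
  rw [cfResFun, inverse_one_sub_cfLOp_of_lt A hA h2 hs]
  have hsum : Summable fun n => cfLOp A hA s ^ n := (summable_norm_cfLOp_pow A hA h2 hs).of_norm
  have h := ((CfLip.eval x).comp (ContinuousLinearMap.apply ℂ CfLip G)).map_tsum hsum
  simpa only [ContinuousLinearMap.coe_comp, Function.comp_apply, ContinuousLinearMap.apply_apply,
    CfLip.eval_apply] using h

omit h2 in
/-- The terms of the series are weighted word sums: `(L_sⁿ G)(x) = Σ_{w ∈ Aⁿ} denom(M_w, x)^{-2s} G(M_w x)`.
[cite: MageeOhWinter2019, §3.1 eq. (3.7)] -/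
theorem cfLOp_pow_apply_eq_sum (s : ℂ) (n : ℕ) (G : CfLip) (x : Icc (0 : ℝ) 1) :
    (cfLOp A hA s ^ n) G x =
      ∑ w : Fin n → A, cfWt s (cfMat fun i => (w i : ℕ)) x * G.extend (cfMoeb (cfMat fun i => (w i : ℕ)) x) := by
  rw [cfLOp_pow_apply, cfLC_iterate hA s _ n x.2, cfLCSum]

omit h2 in
/-- In particular `(L_sⁿ 𝟙)(x) = Σ_{w ∈ Aⁿ} denom(M_w, x)^{-2s}`. [cite: MageeOhWinter2019, §3.1 eq. (3.7)] -/
theorem cfLOp_pow_const_one (s : ℂ) (n : ℕ) (x : Icc (0 : ℝ) 1) :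
    (cfLOp A hA s ^ n) (CfLip.const 1) x = ∑ w : Fin n → A, cfWt s (cfMat fun i => (w i : ℕ)) x := by
  rw [cfLOp_pow_apply_eq_sum]
  refine Finset.sum_congr rfl fun w _ => ?_
  show cfWt s _ x * (CfLip.const 1) (Set.projIcc 0 1 zero_le_one _) = _
  rw [CfLip.const_apply, mul_one]

/-- `ν(𝟙) = 1`. [folklore] -/
theorem cfNuL_const_one : cfNuL A hA h2 (CfLip.const 1) = 1 := by
  rw [cfNuL_of_real A hA h2 (g := fun _ => 1) (fun x => by simp), cfInt]
  simp

/-- `Π 𝟙 = h`. [folklore] -/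
theorem cfPi_const_one : cfPi A hA h2 (CfLip.const 1) = cfHL A hA h2 := by
  rw [cfPi_apply, cfNuL_const_one, one_smul]

/-- **The simple pole of `F_{G,x}` at `δ`:** there are `ε > 0` and `w` continuous at `δ` with
`F_{G,x}(s) = w(s) + ν(G) h(x) / ((s - δ) κ)` for `0 < |s - δ| < ε`, where `κ = ∫ 2 h log(1/·) dν > 0`.
[cite: MageeOhWinter2019, Prop. 17] -/
theorem cfResFun_near_delta (G : CfLip) (x : Icc (0 : ℝ) 1) :
    ∃ ε > 0, ∃ w : ℂ → ℂ, ContinuousAt w (cfDimension A : ℂ) ∧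
      ∀ s ∈ ball (cfDimension A : ℂ) ε, s ≠ (cfDimension A : ℂ) →
        cfResFun A hA G x s = w s +
          ((s - cfDimension A)⁻¹ * ((cfInt (cfNuδ A hA h2) (cfG A hA h2) : ℝ) : ℂ)⁻¹) *
            (cfNuL A hA h2 G * (cfHδ A hA h2 x : ℂ)) := by
  obtain ⟨ε, hε, Wreg, han, hinv⟩ := cfResolvent_pole' A hA h2
  refine ⟨ε, hε, fun s => Wreg s G x, ?_, fun s hs hne => ?_⟩
  · have hΦ : Continuous fun T : CfLip →L[ℂ] CfLip => T G x :=
      (CfLip.eval x).continuous.comp (ContinuousLinearMap.apply ℂ CfLip G).continuous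
    exact hΦ.continuousAt.comp (han _ (mem_ball_self hε)).continuousAt
  · obtain ⟨hl, hr⟩ := hinv s hs hne
    rw [cfResFun, (Ring.inverse_unit ⟨_, _, hl, hr⟩ : Ring.inverse (1 - cfLOp A hA s) = _)]
    show (Wreg s + ((s - cfDimension A)⁻¹ * ((cfInt (cfNuδ A hA h2) (cfG A hA h2) : ℝ) : ℂ)⁻¹) • cfPi A hA h2)
      G x = _
    rw [show ∀ (P Q : CfLip →L[ℂ] CfLip) (F : CfLip), (P + Q) F = P F + Q F from fun _ _ _ => rfl,
      show ∀ (c : ℂ) (P : CfLip →L[ℂ] CfLip) (F : CfLip), (c • P) F = c • P F from fun _ _ _ => rfl,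
      cfPi_apply, smul_smul, CfLip.add_apply, CfLip.smul_apply, cfHL_apply, mul_assoc]

/-- The residue constant is positive: `κ = ∫ 2 h log(1/·) dν > 0` and `h(x) > 0`, so
`h(x)/(δ κ) > 0`. [cite: MageeOhWinter2019, Prop. 17] -/
theorem cfRenewalConst_pos (x : Icc (0 : ℝ) 1) :
    0 < cfHδ A hA h2 x / (cfDimension A * cfInt (cfNuδ A hA h2) (cfG A hA h2)) :=
  div_pos (cfHδ_pos A hA h2 x.2) (mul_pos (cfDimension_pos hA h2) (cfInt_cfG_pos A hA h2))

end HalfPlane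

end Literature.NumberTheory.Sieve
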